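import Literature.Analysis.Calculus.HardyExterior
import Mathlib.MeasureTheory.Integral.Lebesgue.Add
import Mathlib.MeasureTheory.Group.Integral
import HarnessLib

/-!
# Hardy's inequality on the whole space:
# `∫ u²/‖y − x₀‖² ≤ (2/(n − 2))² ∫ ‖Du‖²` (`n ≥ 3`, `u ∈ C¹_c`)

(namespace `Literature.Analysis.Calculus`; companion of `HardyExterior.lean`)

`HardyExterior.lean` proves Hardy's inequality outside a ball of radius `R > 0`,
`∫_{‖y‖ > R} u²/‖y‖² ≤ (2/(n − 2))² ∫_{‖y‖ > R} ‖Du‖²`, for a real finite-dimensional inner product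
space `E` of dimension `n ≥ 3` with its Lebesgue measure and `u ∈ C¹_c(E; ℝ)`. This file lets
`R → 0` (monotone convergence) and translates the centre, giving the classical whole-space
inequality ("uncertainty principle lemma" for `n = 3`, constant `4`):

* `integrable_sq_div_norm_sq`, `hardy_sq_integral_le`: `y ↦ u(y)²/‖y‖²` is integrable and
  `∫ u²/‖y‖² ≤ (2/(n − 2))² ∫ ‖Du‖²`;
* `integrable_sq_div_norm_sub_sq`, `hardy_sq_integral_sub_le`: the same about any centre `x₀`,
  `∫ u(y)²/‖y − x₀‖² dy ≤ (2/(n − 2))² ∫ ‖Du‖²`.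

`‖Du(y)‖` is the operator norm of the differential (`= |∇u(y)|`). The singular weight needs no
principal value: `u²/‖y‖²` is locally integrable in dimension `≥ 3`, which is part of the
conclusion (Lean's `x/0 = 0` makes the integrand `0` at the centre, a null set).

## Proof

For `S_k = {‖y‖ > (k+1)⁻¹}` the exterior inequality bounds `∫_{S_k} u²/‖y‖²` by
`B = (2/(n−2))² ∫ ‖Du‖²` uniformly in `k`; the indicators of `S_k` increase to the indicator of
`{y ≠ 0}`, so `∫⁻ u²/‖y‖² = sup_k ∫⁻_{S_k} u²/‖y‖² ≤ B` (monotone convergence for `∫⁻`), which is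
integrability and the bound at once. The centred version is the change of variables
`y ↦ y + x₀` (translation invariance of Lebesgue measure, `fderiv_comp_add_right`).

## References

* Classical; e.g. the form used for the "Hardy face" of Schrödinger-type bounds
  `−νΔ − V ≥ 0` when `‖y − x₀‖² V ≤ ν (n−2)²/4`. The exterior inequality and its provenance
  (Dafermos–Rodnianski–Shlapentokh-Rothman, arXiv:1402.7034, §4.3) are in `HardyExterior.lean`.
-/

noncomputable section

open MeasureTheory Set Filter Module
open scoped Topology ENNReal

namespace Literature.Analysis.Calculus

variable {E : Type*} [NormedAddCommGroup E] [InnerProductSpace ℝ E] [FiniteDimensional ℝ E]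
  [MeasurableSpace E] [BorelSpace E]

/-! ### From the exterior inequality to the whole space -/

/-- The `∫⁻` form of the whole-space Hardy inequality: for `u ∈ C¹_c(E)`, `dim E ≥ 3`,
`∫⁻ ofReal (u²/‖y‖²) ≤ ofReal ((2/(n−2))² ∫ ‖Du‖²)` (monotone convergence from
`hardy_sq_integral_exterior_le` over the exteriors `{‖y‖ > (k+1)⁻¹}`). [folklore] -/
theorem lintegral_sq_div_norm_sq_le {u : E → ℝ} (hu : ContDiff ℝ 1 u) (hc : HasCompactSupport u)
    (hn : 3 ≤ finrank ℝ E) :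
    ∫⁻ y, ENNReal.ofReal (u y ^ 2 / ‖y‖ ^ 2) ≤
      ENNReal.ofReal ((2 / ((finrank ℝ E : ℝ) - 2)) ^ 2 * ∫ y, ‖fderiv ℝ u y‖ ^ 2) := by
  set C : ℝ := (2 / ((finrank ℝ E : ℝ) - 2)) ^ 2 with hC
  set f : E → ℝ := fun y ↦ u y ^ 2 / ‖y‖ ^ 2 with hf
  have huc : Continuous u := hu.continuous
  have hDc : Continuous (fderiv ℝ u) := hu.continuous_fderiv one_ne_zero
  have hfm : Measurable f :=
    (huc.measurable.pow_const 2).div (continuous_norm.measurable.pow_const 2)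
  have hf0 : ∀ y, 0 ≤ f y := fun y ↦ div_nonneg (sq_nonneg _) (sq_nonneg _)
  -- the full Dirichlet integral dominates the exterior ones
  have hK : IsCompact (tsupport u) := hc
  have hz : ∀ y ∉ tsupport u, u y = 0 := fun y hy ↦ image_eq_zero_of_notMem_tsupport hy
  have hDz : ∀ y ∉ tsupport u, fderiv ℝ u y = 0 := fun y hy ↦ fderiv_of_notMem_tsupport ℝ hy
  have hcs : ∀ {φ : E → ℝ}, (∀ y ∉ tsupport u, φ y = 0) → HasCompactSupport φ :=
    fun h ↦ HasCompactSupport.intro hK h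
  have hD2i : Integrable fun y ↦ ‖fderiv ℝ u y‖ ^ 2 :=
    ((continuous_norm.comp hDc).pow 2).integrable_of_hasCompactSupport
      (hcs fun y hy ↦ by simp [hDz y hy])
  -- the exteriors `S k = {‖y‖ > (k+1)⁻¹}`
  set S : ℕ → Set E := fun k ↦ {y : E | ((k : ℝ) + 1)⁻¹ < ‖y‖} with hS
  have hSm : ∀ k, MeasurableSet (S k) := fun k ↦
    (isOpen_lt continuous_const continuous_norm).measurableSet
  have hSmono : ∀ {k l : ℕ}, k ≤ l → S k ⊆ S l := by
    intro k l hkl y hy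
    have hk1 : (0 : ℝ) < (k : ℝ) + 1 := by positivity
    have hkl' : ((l : ℝ) + 1)⁻¹ ≤ ((k : ℝ) + 1)⁻¹ :=
      inv_anti₀ hk1 (by exact_mod_cast Nat.succ_le_succ hkl)
    exact lt_of_le_of_lt hkl' hy
  -- on each exterior: integrable, and Hardy's exterior bound
  have hfi : ∀ k, IntegrableOn f (S k) := by
    intro k
    set R : ℝ := ((k : ℝ) + 1)⁻¹ with hR
    have hRpos : 0 < R := by positivity
    have hg : Integrable fun y : E ↦ (R ^ 2)⁻¹ * u y ^ 2 :=
      ((huc.pow 2).integrable_of_hasCompactSupport (hcs fun y hy ↦ by simp [hz y hy])).const_mul _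
    refine Integrable.mono' hg.integrableOn hfm.aestronglyMeasurable
      (ae_restrict_of_forall_mem (hSm k) fun y hy ↦ ?_)
    have hy' : R < ‖y‖ := hy
    rw [Real.norm_eq_abs, abs_of_nonneg (hf0 y), hf]
    dsimp only
    rw [div_eq_inv_mul]
    have hRy : R ^ 2 ≤ ‖y‖ ^ 2 := pow_le_pow_left₀ hRpos.le hy'.le 2
    have hR2 : 0 < R ^ 2 := by positivity
    exact mul_le_mul_of_nonneg_right ((inv_le_inv₀ (hR2.trans_le hRy) hR2).2 hRy) (sq_nonneg _)
  have hbound : ∀ k, ∫ y in S k, f y ≤ C * ∫ y, ‖fderiv ℝ u y‖ ^ 2 := by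
    intro k
    have hRpos : (0 : ℝ) < ((k : ℝ) + 1)⁻¹ := by positivity
    refine (hardy_sq_integral_exterior_le hu hc hRpos hn).trans ?_
    refine mul_le_mul_of_nonneg_left ?_ (by positivity)
    exact setIntegral_le_integral hD2i (ae_of_all _ fun y ↦ sq_nonneg _)
  -- monotone convergence: `ofReal ∘ f = ⨆ k, 𝟙_{S k} (ofReal ∘ f)` pointwise (`f 0 = 0`)
  set g : ℕ → E → ℝ≥0∞ := fun k ↦ (S k).indicator fun y ↦ ENNReal.ofReal (f y) with hg
  have hgm : ∀ k, Measurable (g k) := fun k ↦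
    (ENNReal.measurable_ofReal.comp hfm).indicator (hSm k)
  have hgmono : Monotone g := by
    intro k l hkl y
    exact indicator_le_indicator_of_subset (hSmono hkl) (fun _ ↦ zero_le) y
  have hsup : ∀ y, (⨆ k, g k y) = ENNReal.ofReal (f y) := by
    intro y
    refine le_antisymm (iSup_le fun k ↦ indicator_le_self _ _ y) ?_
    by_cases hy : y = 0
    · have : f y = 0 := by simp [hf, hy]
      simp [this]
    · obtain ⟨k, hk⟩ := exists_nat_one_div_lt (norm_pos_iff.2 hy)
      have hyk : y ∈ S k := by
        show ((k : ℝ) + 1)⁻¹ < ‖y‖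
        rwa [one_div] at hk
      calc ENNReal.ofReal (f y) = g k y := by simp [hg, indicator_of_mem hyk]
        _ ≤ ⨆ k, g k y := le_iSup (fun k ↦ g k y) k
  calc ∫⁻ y, ENNReal.ofReal (f y) = ∫⁻ y, ⨆ k, g k y := by simp_rw [hsup]
    _ = ⨆ k, ∫⁻ y, g k y := lintegral_iSup hgm hgmono
    _ ≤ ENNReal.ofReal (C * ∫ y, ‖fderiv ℝ u y‖ ^ 2) := by
      refine iSup_le fun k ↦ ?_
      calc ∫⁻ y, g k y = ∫⁻ y in S k, ENNReal.ofReal (f y) := lintegral_indicator (hSm k) _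
        _ = ENNReal.ofReal (∫ y in S k, f y) :=
          (ofReal_integral_eq_lintegral_ofReal (hfi k) (ae_of_all _ fun y ↦ hf0 y)).symm
        _ ≤ ENNReal.ofReal (C * ∫ y, ‖fderiv ℝ u y‖ ^ 2) := ENNReal.ofReal_le_ofReal (hbound k)

/-- **Local integrability of the Hardy weight.** For `u ∈ C¹_c(E)` with `dim E ≥ 3`, the function
`y ↦ u(y)²/‖y‖²` is integrable on `E` (value `0` at `y = 0` by `x/0 = 0`, a null set). [folklore] -/
theorem integrable_sq_div_norm_sq {u : E → ℝ} (hu : ContDiff ℝ 1 u) (hc : HasCompactSupport u)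
    (hn : 3 ≤ finrank ℝ E) : Integrable fun y ↦ u y ^ 2 / ‖y‖ ^ 2 := by
  have hfm : Measurable fun y ↦ u y ^ 2 / ‖y‖ ^ 2 :=
    (hu.continuous.measurable.pow_const 2).div (continuous_norm.measurable.pow_const 2)
  refine ⟨hfm.aestronglyMeasurable, ?_⟩
  rw [hasFiniteIntegral_iff_enorm]
  have he : ∀ y : E, ‖u y ^ 2 / ‖y‖ ^ 2‖ₑ = ENNReal.ofReal (u y ^ 2 / ‖y‖ ^ 2) := fun y ↦
    Real.enorm_eq_ofReal (div_nonneg (sq_nonneg _) (sq_nonneg _))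
  simp_rw [he]
  exact (lintegral_sq_div_norm_sq_le hu hc hn).trans_lt ENNReal.ofReal_lt_top

/-- **Hardy's inequality on the whole space** (`n = dim E ≥ 3`): for `u ∈ C¹_c(E)`,
`∫ u²/‖y‖² ≤ (2/(n − 2))² ∫ ‖Du‖²`; for `n = 3` the constant is `4`. [folklore] -/
theorem hardy_sq_integral_le {u : E → ℝ} (hu : ContDiff ℝ 1 u) (hc : HasCompactSupport u)
    (hn : 3 ≤ finrank ℝ E) :
    ∫ y, u y ^ 2 / ‖y‖ ^ 2 ≤ (2 / ((finrank ℝ E : ℝ) - 2)) ^ 2 * ∫ y, ‖fderiv ℝ u y‖ ^ 2 := by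
  have h0 : ∀ y : E, 0 ≤ u y ^ 2 / ‖y‖ ^ 2 := fun y ↦ div_nonneg (sq_nonneg _) (sq_nonneg _)
  have hB : 0 ≤ (2 / ((finrank ℝ E : ℝ) - 2)) ^ 2 * ∫ y, ‖fderiv ℝ u y‖ ^ 2 :=
    mul_nonneg (sq_nonneg _) (integral_nonneg fun y ↦ sq_nonneg _)
  rw [integral_eq_lintegral_of_nonneg_ae (ae_of_all _ h0)
    (integrable_sq_div_norm_sq hu hc hn).aestronglyMeasurable]
  exact ENNReal.toReal_le_of_le_ofReal hB (lintegral_sq_div_norm_sq_le hu hc hn)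

/-! ### Arbitrary centre -/

/-- Translating the centre: `y ↦ u(y)²/‖y − x₀‖²` is integrable for `u ∈ C¹_c(E)`, `dim E ≥ 3`.
[folklore] -/
theorem integrable_sq_div_norm_sub_sq {u : E → ℝ} (hu : ContDiff ℝ 1 u) (hc : HasCompactSupport u)
    (hn : 3 ≤ finrank ℝ E) (x₀ : E) : Integrable fun y ↦ u y ^ 2 / ‖y - x₀‖ ^ 2 := by
  have hv : ContDiff ℝ 1 fun y ↦ u (y + x₀) := hu.comp (contDiff_id.add contDiff_const)
  have hvc : HasCompactSupport fun y ↦ u (y + x₀) := hc.comp_homeomorph (Homeomorph.addRight x₀)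
  have h := (integrable_sq_div_norm_sq hv hvc hn).comp_sub_right x₀
  simpa only [sub_add_cancel] using h

/-- **Hardy's inequality about an arbitrary centre** (`n = dim E ≥ 3`): for `u ∈ C¹_c(E)` and
`x₀ ∈ E`, `∫ u(y)²/‖y − x₀‖² dy ≤ (2/(n − 2))² ∫ ‖Du‖²` (constant `4` for `n = 3`). [folklore] -/
theorem hardy_sq_integral_sub_le {u : E → ℝ} (hu : ContDiff ℝ 1 u) (hc : HasCompactSupport u)
    (hn : 3 ≤ finrank ℝ E) (x₀ : E) :
    ∫ y, u y ^ 2 / ‖y - x₀‖ ^ 2 ≤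
      (2 / ((finrank ℝ E : ℝ) - 2)) ^ 2 * ∫ y, ‖fderiv ℝ u y‖ ^ 2 := by
  have hv : ContDiff ℝ 1 fun y ↦ u (y + x₀) := hu.comp (contDiff_id.add contDiff_const)
  have hvc : HasCompactSupport fun y ↦ u (y + x₀) := hc.comp_homeomorph (Homeomorph.addRight x₀)
  have h := hardy_sq_integral_le hv hvc hn
  have h1 : ∫ y, u (y + x₀) ^ 2 / ‖y‖ ^ 2 = ∫ y, u y ^ 2 / ‖y - x₀‖ ^ 2 := by
    have := integral_sub_right_eq_self (μ := (volume : Measure E))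
      (fun y ↦ u (y + x₀) ^ 2 / ‖y‖ ^ 2) x₀
    simpa only [sub_add_cancel] using this.symm
  have h2 : ∫ y, ‖fderiv ℝ (fun y ↦ u (y + x₀)) y‖ ^ 2 = ∫ y, ‖fderiv ℝ u y‖ ^ 2 := by
    simp_rw [fderiv_comp_add_right]
    exact integral_add_right_eq_self (μ := (volume : Measure E)) (fun y ↦ ‖fderiv ℝ u y‖ ^ 2) x₀
  rwa [h1, h2] at h

end Literature.Analysis.Calculus

end
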